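import Summits.BirchSwinnertonDyer.BirchSwinnertonDyer.Theorems.ByReductionTypeAtTwoOrdKatoHalfAtTwoIsoGreenbergMuDefs
import Literature.NumberTheory.EllipticCurves.Kato2004.LocalIwasawaCohomologyPoitouTateProofs
import Literature.NumberTheory.EllipticCurves.IwasawaAlgebraProofs
import Literature.NumberTheory.EllipticCurves.IwasawaSelmerModuleFiniteProofs
import Literature.NumberTheory.EllipticCurves.IwasawaSelmerDualProofs
import Literature.Uncategorized.OrdPublishedInputsAtTwo
import HarnessLib

/-!
# Cert47s1c — crux-triage r1 seat 1/2, GEN 47 (refuter; crux `OrdKatoHalfAtTwoIso`, stmt-BirchSwinnertonDyer-19573)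
# VET AT LANDING of w3 GEN 6's proof file p733613 (`Literature/…/Kato2004/LocalIwasawaCohomologyPoitouTateProofs.lean`,
# ACCEPTED 2026-08-29T16:51Z, commit 532f384f3775), read BY NAME against the REGISTERED v23 stub texts (skeleton 33b5bb88).
# ROUTE-FILE-FREE (Literature + the landed G11⁺ def p733065 only; the K4 `Theses.ByReductionTypeAtTwo` cone is stale on the farm).

HONEST FRAMING. Evidence for a triage verdict, NOT a Theorems landing, NOT a proof of anything open: BSD is not proved, crux 202 is
not proved; G11⁺ (Greenberg LNM 1716 Conj. 1.11 at `p = 2` on the cell, p. 64), `OrdPublishedInputsAtTwo` and Kato's Λ-adic Poitou–Tate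
exactness (p729889) are displayed as HYPOTHESES wherever they occur.  What the kernel certifies here:
  (A) `stubTateDualityTowerType_of_poitouTate_exact` — the registered cite stub `stub_tateDualityTower` (TYPE
      `Kato2004.exists_lambdaAdicLocalTatePairing_selmer_orthogonal`, p723619) is SERVED BY NAME by p729889's fact (p733613's
      `…_of_poitouTate_exact`): executing v24 (i) (re-cite to p729889) or not changes nothing provable.
  (B) `vFlatPosDiscCell_of_g11Landed_of_pub_of_poitouTate` — V♭⁺ RESTRICTED TO THE CELL (the registered v23 text
      `stub_muFreeValue_posDisc_two`, Lines l. 491–510 VERBATIM, with the two habitat binders `¬ W.HasCM → W.analyticRank = 0 →`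
      inserted) follows from the LANDED G11⁺ `GreenbergMuZeroTwoOrdPosDisc` (p733065) + PUB (Λ-cotorsion = Kato 17.4 (1) at 2 via
      modularity, rank-free) + p729889, through p733613's `exists_notMem_col_loc_of_poitouTate_of_moduleFinite`, the tree's structure
      theorem `muInvariant_eq_zero_iff_holds` (μ = 0 ∧ torsion ⟺ f.g. over ℤ₂) and `SelmerDualData.module_finite_holds` /
      `nonempty_selmerDualData_holds`.  READING: the v24 (ii) merge {V♭⁺, Q⁺} ↦ G11⁺ loses NO consequence of V♭⁺ AT CELL CURVES even for
      the displayed W2⁺ / P⁺ chain (F-45b (⇒) and F-46b «lossless relative to the cone», now BY LANDED NAMES); the rank-free excess of the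
      registered V♭⁺ (r_an ≥ 1 onto curves, 0 < Δ) is NOT recovered — G11⁺ is silent there (F-46b), and nothing in the cone used it.
-/

set_option autoImplicit false
set_option linter.dupNamespace false

noncomputable section

open scoped Classical MatrixGroups ModularForm NumberField
open CongruenceSubgroup WeierstrassCurve Field IsDedekindDomain
open Literature.NumberTheory.GaloisRepresentations
open Literature.NumberTheory.EllipticCurves Literature.NumberTheory.EllipticCurves.ModularForms
open Literature.NumberTheory.EllipticCurves.GreenbergSelmer
open Literature.NumberTheory.EllipticCurves.Kato2004 Literature.NumberTheory.EllipticCurves.Kato2004.EulerSystemValues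
open Literature.NumberTheory.EllipticCurves.Rank1Residual
open Summit.BirchSwinnertonDyer.BirchSwinnertonDyer.Theorems.SteinbergFibreAtTwo

namespace Summit.BirchSwinnertonDyer.BirchSwinnertonDyer.Cruxes.OrdKatoHalfAtTwoIso.TriageCert47s1c

/-- (A) **The registered cite stub's TYPE is served by p729889 by name** (p733613, projection dropping clause (E)). [folklore] -/
theorem stubTateDualityTowerType_of_poitouTate_exact (h : exists_lambdaAdicLocalTatePairing_poitouTate_exact) :
    exists_lambdaAdicLocalTatePairing_selmer_orthogonal :=
  exists_lambdaAdicLocalTatePairing_selmer_orthogonal_of_poitouTate_exact h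

/-- **V♭⁺ ON THE CELL** — the registered v23 stub text `stub_muFreeValue_posDisc_two` (skeleton 33b5bb88, Lines l. 491–510) VERBATIM,
with the two habitat binders `¬ W.HasCM → W.analyticRank = 0 →` inserted after `hγ`.  Displayed; nothing asserted.
[cite: Kato2004Asterisque, Thm. 12.5 (1) (p. 221), Prop. 17.11 (p. 277) (shape)] [cite: GreenbergLNM1716, Conj. 1.11 (p. 64) (shape)] -/
def VFlatPosDiscCellText : Prop := ∀ (W : WeierstrassCurve ℚ) [W.IsElliptic] [W.IsGloballyMinimal]
      [ContinuousSMul ℤ_[2] (W.tateModule 2)] [Module.Free ℤ_[2] (W.tateModule 2)] [Module.Finite ℤ_[2] (W.tateModule 2)]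
      {N : ℕ} [NeZero N] (f : CuspForm (Gamma0 N) 2)
      (κ : ZpExtension ℚ 2) (γ : absoluteGaloisGroup ℚ) (hκ : κ.IsCyclotomic) (hγ : κ.IsTopGenerator γ),
      ¬ W.HasCM → W.analyticRank = 0 →
      0 < W.Δ → IsOrdinaryAt W 2 → W.HasSurjectiveModNGaloisRep 2 → IsCyclotomicVariable 2 γ → IsNewformOf W f →
      ∀ (v₂ : HeightOneSpectrum (𝓞 ℚ)) (_ : ((2 : ℕ) : 𝓞 ℚ) ∈ v₂.asIdeal)
        (γᵥ : absoluteGaloisGroup (v₂.adicCompletion ℚ))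
        (hsurj : Function.Surjective
          (κ.toContinuousMonoidHom.comp (resGalOfEmb (closureEmb (K := ℚ) (v₂.adicCompletion ℚ)))))
        (hγᵥ : κ.IsTopGenerator (resGalOfEmb (closureEmb (K := ℚ) (v₂.adicCompletion ℚ)) γᵥ))
        (I : IwasawaH1Data W 2 κ γ) (J : LocalIwasawaH1Data κ v₂ ((tateRep W 2).toLocal v₂) γᵥ)
        (J' : LocalIwasawaH1Data κ v₂ (tateLocalOrdinaryRep W 2 v₂) γᵥ)
        (col : J.H →ₗ[IwasawaAlgebra 2] IwasawaAlgebra 2),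
        (∀ x : J.H, col x = 0 ↔ x ∈ LinearMap.range (J'.ordinaryInclusion J)) →
        (∃ x : J.H, col x ∉ IwasawaAlgebra.augIdealP 2) →
        ∃ y : I.H, col (I.loc J hsurj hγ hγᵥ y) ∉ IwasawaAlgebra.augIdealP 2

/-- **Λ-cotorsion on the cell is PRINT** (= `Cert47s1a.isTorsion_of_pub`): PUB's third conjunct `kato_divisibility_allPrimes W 2` (Kato
17.4 (1) at 2) with a newform from PUB's first conjunct (modularity); rank-free, CM-free. [cite: Kato2004Asterisque, Thm. 17.4 (1) (p. 274)] -/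
theorem isTorsion_of_pub (hPub : Literature.Uncategorized.OrdPublishedInputsAtTwo) (W : WeierstrassCurve ℚ) [W.IsElliptic]
    [W.IsGloballyMinimal] (hgo : GoodOrd W 2) {κ : ZpExtension ℚ 2} {γ : absoluteGaloisGroup ℚ} (hκ : κ.IsCyclotomic)
    (hγ : κ.IsTopGenerator γ) (hγ' : IsCyclotomicVariable 2 γ) (D : W.SelmerDualData κ γ) : D.IsTorsion := by
  haveI : NeZero (W.conductorNorm ℤ) := ⟨(W.conductorNorm_pos_holds).ne'⟩
  have hord : IsOrdinaryAt W 2 := ⟨hgo.1, hgo.2⟩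
  obtain ⟨hmod, _, h17, _⟩ := hPub
  obtain ⟨Dm⟩ := hmod W
  exact (h17 W Dm.f κ γ hκ hγ hγ' hord Dm.isNewformOf D).1

/-- (B) **G11⁺ (landed, p733065) + PUB + Kato's Λ-adic Poitou–Tate exactness (p729889) ⟹ V♭⁺ on the cell**, by landed names only:
`D` from `nonempty_selmerDualData_holds`; `D.mu = 0` from G11⁺; torsion from PUB; f.g. over `Λ` from `module_finite_holds`; f.g. over `ℤ₂`
from `muInvariant_eq_zero_iff_holds`; the value on `loc₂ 𝐇¹_Γ` from p733613.  CONDITIONAL display; nothing about any curve is asserted.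
[cite: GreenbergLNM1716, Conj. 1.11 (p. 64), §4 p. 122] [cite: Kato2004Asterisque, §17.13 (p. 279)] -/
theorem vFlatPosDiscCell_of_g11Landed_of_pub_of_poitouTate (hG : GreenbergMuZeroTwoOrdPosDisc)
    (hPub : Literature.Uncategorized.OrdPublishedInputsAtTwo) (hPT : exists_lambdaAdicLocalTatePairing_poitouTate_exact) :
    VFlatPosDiscCellText := by
  intro W _ _ _ _ _ _N _ _f κ γ hκ hγ hCM hr hΔ hord h2 hγ' _hf v₂ hv₂ γᵥ hsurj hγᵥ I J J' col hker hnorm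
  have hgo : GoodOrd W 2 := ⟨hord.1, hord.2⟩
  obtain ⟨D⟩ := WeierstrassCurve.nonempty_selmerDualData_holds (W := W) (κ := κ) γ hγ
  have hμ : D.mu = 0 := hG W hCM hr hgo h2 hΔ κ γ hκ hγ hγ' D
  have htors : D.IsTorsion := isTorsion_of_pub hPub W hgo hκ hγ hγ' D
  haveI : Module.Finite (IwasawaAlgebra 2) D.X := D.module_finite_holds hγ
  have hfin : Module.Finite ℤ_[2] (RestrictScalars ℤ_[2] (IwasawaAlgebra 2) D.X) :=
    (muInvariant_eq_zero_iff_holds 2 D.X htors).mp hμ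
  exact exists_notMem_col_loc_of_poitouTate_of_moduleFinite hPT W κ γ hκ hγ hord v₂ hv₂ γᵥ hsurj hγᵥ I J J' D hfin col
    (fun y => (hker _).mpr (LinearMap.mem_range_self _ y)) hnorm

end Summit.BirchSwinnertonDyer.BirchSwinnertonDyer.Cruxes.OrdKatoHalfAtTwoIso.TriageCert47s1c

end
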